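import Literature.NumberTheory.Transcendental.RoySmallValueFactorizationK
import Literature.NumberTheory.Transcendental.RoySmallValueLinearFactorsFintype
import Literature.NumberTheory.Transcendental.RoySmallValueVeronese
import HarnessLib

/-!
# Roy's small value estimate for `𝔾ₐ × 𝔾ₘ` — the height of the zero-cycle of `(P, Q)` is bounded by the length of `Φ(P, Q, ·)`

Topic `Literature/NumberTheory/Transcendental`. Part of the formalisation of the proof of Roy 2013,
Theorem 1.1 (named fact `roy2013_thm_1_1`, `RoySmallValueEstimates.lean`), seat B. Source: D. Roy,
*A small value estimate for `𝔾ₐ × 𝔾ₘ`*, Mathematika 59 (2013) 333–363 = arXiv:1301.0663,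
Proposition 2.2 (ii) (p. 6) and its use in §6, proof of Proposition 6.4 (p. 17):

> **Proposition 2.2.** [...] (ii) [...] `h(W · Z) ≤ D h(Z) + deg(Z) log ‖P‖ + [...]`
> [...] `h(Z) ≤ h(𝒵(P,Q)) ≤ D h(𝒵(P)) + D log‖Q‖ + 8 log(3) D² ≤ D (log‖P‖ + log‖Q‖) + [...]`.

In this development the arithmetic Bézout inequality is replaced by the Gelfond–Mahler inequality
for the linear factors of the INTEGER polynomial `F₀ = Φ(P₀, Q₀, ·)` (`royF` over `ℤ`): if over a
number field `K` (with a complex embedding `ι₀`) `F₀ = c' ∏ᵢ ℓ_{αᵢ}^{eᵢ}` with points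
`αᵢ ∈ K³ ∖ 0`, then

  `∑ᵢ eᵢ · D · h_K(αᵢ) ≤ [K:ℚ] · log 𝓛(F₀)`      (`sum_mul_height_le_log_length`),

`h_K = Height.logHeight` (relative to `K`), `𝓛(F₀) = ∑ |coefficients|`: this is
`sum_mul_logHeight_le'` (`RoySmallValueLinearFactorsFintype`) for the coefficient vectors
`(αᵢ^ν)_ν` of the point forms combined with the Veronese identity `h((α^ν)_ν) = D h(α)`
(`RoySmallValueVeronese.logHeight_veronese`). Together with the descent of the complex
factorisation `royF_eq_C_mul_prod` to `K` (`RoySmallValueFactorizationK`) this gives the same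
bound starting from the factorisation over `ℂ` (`sum_mul_height_le_log_length_of_complex`), and
with `map_royF` the version for `F₀ = royF … P₀ Q₀`, `P₀, Q₀ ∈ ℤ[X]_D`
(`sum_mul_height_le_log_length_royF`). Dividing by `[K:ℚ]` and grouping the `αᵢ` into Galois
orbits `Z` (on which `eᵢ` is constant, `exponent_perm_eq`) this reads `∑_Z e_Z D h(Z) ≤ log 𝓛(F₀)`,
Roy's `D h(Z) ≤ …` for every component. Everything is proved; no definitions, no named facts.

## References

* [Roy2013] D. Roy, *A small value estimate for 𝔾ₐ × 𝔾ₘ*, Mathematika 59 (2013), 333–363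
  (arXiv:1301.0663), Proposition 2.2 (ii); §6, proof of Proposition 6.4; §7 Step 3 (`h(Z) ≤ …`).
-/

noncomputable section

open MvPolynomial Finset Height

namespace Literature.NumberTheory.Transcendental

namespace Roy2013

variable {K : Type*} [Field K] [NumberField K] {D : ℕ}

omit [NumberField K] in
/-- The Veronese vector of a non-zero point is non-zero. [folklore] -/
theorem veronese_ne_zero {a : Fin 3 → K} (ha : a ≠ 0) :
    (fun ν : CoefIdx D => ∏ k, a k ^ (ν.1 k)) ≠ 0 := by
  obtain ⟨k, hk⟩ : ∃ k, a k ≠ 0 := by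
    by_contra h0
    exact ha (funext fun k => by simpa using not_exists.mp h0 k)
  intro h
  have h1 := congrFun h ⟨Finsupp.single k D, single_mem_finsuppAntidiag k⟩
  rw [Pi.zero_apply, prod_pow_single] at h1
  exact pow_ne_zero D hk h1

/-- **`∑ᵢ eᵢ D h_K(αᵢ) ≤ [K:ℚ] log 𝓛(F₀)`** for an integer polynomial `F₀ ≠ 0` on the coefficient
space of `ℂ[X]_D` factoring over the number field `K` as `c' ∏ᵢ ℓ_{αᵢ}^{eᵢ}` (`αᵢ ≠ 0`).
[cite: Roy2013, Proposition 2.2 (ii) and §6, proof of Proposition 6.4 — replaced by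
Gelfond–Mahler on the linear factors] -/
theorem sum_mul_height_le_log_length {m : ℕ} {α : Fin m → Fin 3 → K} (hα0 : ∀ i, α i ≠ 0)
    {F₀ : MvPolynomial (CoefIdx D) ℤ} (hF₀ : F₀ ≠ 0) {c' : K} {e : Fin m → ℕ}
    (hfac : map (Int.castRingHom K) F₀ = C c' * ∏ i, evalFormK D (α i) ^ e i) :
    ∑ i, (e i : ℝ) * (D * logHeight (α i)) ≤
      Module.finrank ℚ K * Real.log (∑ m ∈ F₀.support, |((coeff m F₀ : ℤ) : ℝ)|) := by
  haveI : Nonempty (CoefIdx D) :=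
    ⟨⟨Finsupp.single 0 D, single_mem_finsuppAntidiag 0⟩⟩
  have h := sum_mul_logHeight_le' (K := K) hF₀ (c := fun i (ν : CoefIdx D) => ∏ k, α i k ^ (ν.1 k))
    (fun i => veronese_ne_zero (hα0 i)) (e := e) (a := c') (by rw [hfac]; rfl)
  refine le_trans (le_of_eq (Finset.sum_congr rfl fun i _ => ?_)) h
  rw [logHeight_veronese (α i) (hα0 i)]

/-- The same bound starting from a factorisation over `ℂ` of the complexification (descent to `K`
by `exists_descend_factorisation`). [cite: Roy2013, §6, proof of Proposition 6.4] -/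
theorem sum_mul_height_le_log_length_of_complex (ι₀ : K →+* ℂ) {m : ℕ} {α : Fin m → Fin 3 → K}
    (hα0 : ∀ i, α i ≠ 0) {F₀ : MvPolynomial (CoefIdx D) ℤ} (hF₀ : F₀ ≠ 0) {c : ℂ} {e : Fin m → ℕ}
    (hfac : map (Int.castRingHom ℂ) F₀ = C c * ∏ i, evalForm D (ι₀ ∘ α i) ^ e i) :
    ∑ i, (e i : ℝ) * (D * logHeight (α i)) ≤
      Module.finrank ℚ K * Real.log (∑ m ∈ F₀.support, |((coeff m F₀ : ℤ) : ℝ)|) := by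
  have hmap : map ι₀ (map (Int.castRingHom K) F₀) = map (Int.castRingHom ℂ) F₀ := by
    rw [MvPolynomial.map_map]
    exact congrArg (fun φ : ℤ →+* ℂ => MvPolynomial.map φ F₀) (RingHom.ext_int _ _)
  obtain ⟨c', -, hfacK⟩ := exists_descend_factorisation ι₀ hα0 (F₀ := map (Int.castRingHom K) F₀)
    (c := c) (e := e) (by rw [hmap]; exact hfac)
  exact sum_mul_height_le_log_length hα0 hF₀ hfacK

/-- **The bound for `F₀ = Φ(P₀, Q₀, ·)`**: if `P₀, Q₀ ∈ ℤ[X]` and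
`Φ(P₀ ⊗ ℂ, Q₀ ⊗ ℂ, ·) = c ∏ᵢ ℓ_{ι₀ αᵢ}^{eᵢ}` over `ℂ` (`royF_eq_C_mul_prod`) with `K`-rational
points `αᵢ`, then `∑ᵢ eᵢ D h_K(αᵢ) ≤ [K:ℚ] log 𝓛(royF … P₀ Q₀)`.
[cite: Roy2013, §6, proof of Proposition 6.4; §7, Step 3 (`h(Z) ≤ 6(D*+1)^{1+β}/⌊(D*+1)^τ⌋`)] -/
theorem sum_mul_height_le_log_length_royF (ι₀ : K →+* ℂ) {M₁ M₂ : Finset (Fin 3 →₀ ℕ)}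
    (σ : PhiCol D M₁ M₂ ≃ PhiRow D) (P₀ Q₀ : MvPolynomial (Fin 3) ℤ) {m : ℕ}
    {α : Fin m → Fin 3 → K} (hα0 : ∀ i, α i ≠ 0) {c : ℂ} {e : Fin m → ℕ}
    (hF0 : royF D M₁ M₂ σ P₀ Q₀ ≠ 0)
    (hfac : royF D M₁ M₂ σ (map (Int.castRingHom ℂ) P₀) (map (Int.castRingHom ℂ) Q₀) =
      C c * ∏ i, evalForm D (ι₀ ∘ α i) ^ e i) :
    ∑ i, (e i : ℝ) * (D * logHeight (α i)) ≤
      Module.finrank ℚ K * Real.log (∑ m ∈ (royF D M₁ M₂ σ P₀ Q₀).support,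
        |((coeff m (royF D M₁ M₂ σ P₀ Q₀) : ℤ) : ℝ)|) :=
  sum_mul_height_le_log_length_of_complex ι₀ hα0 hF0 (by rw [map_royF]; exact hfac)

/-- `royF` over `ℤ` is non-zero as soon as its complexification is. [folklore] -/
theorem royF_int_ne_zero {M₁ M₂ : Finset (Fin 3 →₀ ℕ)} (σ : PhiCol D M₁ M₂ ≃ PhiRow D)
    {P₀ Q₀ : MvPolynomial (Fin 3) ℤ}
    (h : royF D M₁ M₂ σ (map (Int.castRingHom ℂ) P₀) (map (Int.castRingHom ℂ) Q₀) ≠ 0) :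
    royF D M₁ M₂ σ P₀ Q₀ ≠ 0 := fun h0 => h (by rw [← map_royF, h0, map_zero])

end Roy2013

end Literature.NumberTheory.Transcendental
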